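import Mathlib
import HarnessLib
import Summits.ResolutionOfSingularities.ResolutionOfSingularities.Theorems.WildQuotientsWildQuotientResolutionToricExitRootChartPresentation
import Summits.ResolutionOfSingularities.ResolutionOfSingularities.Theorems.WildQuotientsWildQuotientResolutionToricExitRootSubstInjective
import Summits.ResolutionOfSingularities.ResolutionOfSingularities.Theorems.WildQuotientsWildQuotientResolutionJordanFiveX0ChartTools
import Summits.ResolutionOfSingularities.ResolutionOfSingularities.Theorems.WildQuotientsWildQuotientResolutionJordanFiveI12Stable
import Summits.ResolutionOfSingularities.ResolutionOfSingularities.Theorems.WildQuotientsWildQuotientResolutionQuarter1123WeightZero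

/-!
# RUNG V5 (A1): the `μ₄` vertex chart ring `(k[x][I₁₂t])_{(x_a³t)}` IS the weight-`0` model `E₀`
(crux stmt-ResolutionOfSingularities-15640 `WildQuotients.WildQuotientResolution`, line `Sketch`;
chain w45c RUNG V5, res-L1-w45c-plan-1 ORDER 2026-08-27T14:10:40Z «(A1) = lead-1» (swap with
res-L1-w45c-stub-5); input (A1) of res-L1-w45c-stub-4's one-shot assembly `brickHP0'` through
`JordanFive.coneBrick_zero_of_ringBrick'` (p536645). [OURS · L1 W4.5c] — NOT a statement of any
manuscript; replaces the role of no printed item. Lead prover res-L1-w45c-lead-1.)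

`JordanFive.exists_ringEquiv_blowupChart0_weightZero`: for the chart ring
`chartRing (gens12 k n a b c d) 0 = (k[x][I₁₂t])_{(x_a³ t)} = k[x][I₁₂/x_a³]` of `V = Bl_{I₁₂} 𝔸ⁿ`
at the `μ₄` vertex and ANY subalgebra `E ⊆ k[x]` that is the weight-`0` part for a `μ₄`-weight
`w : Fin n → ZMod 4` with `w(a,b,c,d) = (1,1,2,3)`, `0` elsewhere (the letters of res-L1-w45c-stub-2's
`exists_ringBrick_X0_model`): an isomorphism `eE : chartRing (gens12 …) 0 ≃+* E` with
`eE (F/1) = ψ₀ F` for the ROOT SUBSTITUTION `ψ₀ : x_a ↦ x_a⁴, x_b ↦ x_a³x_b, x_c ↦ x_a²x_c,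
x_d ↦ x_ax_d, x_i ↦ x_i` (stub-2's `root5`, p535906) and
`eE ((g_jt)/(x_a³t)) = x_a^{4α+3β+2γ+δ−12} x_b^β x_c^γ x_d^δ` (`(α,β,γ,δ) = exps12 j`). Engine:
`ToricExit.nonempty_chartRing_ringEquiv_adjoin_of_rootData` (p489374: `ψ₀` injective by
`ToricExit.monomialTwist_injective` p489384, `ψ₀(x_a³) · 1 = (x_a³)⁴`, `ψ₀(g_j) = q_j · ψ₀(x_a³)` by
stub-2's `aeval_root5_gens12`) and res-type-036's `Quarter1123.mem_adjoin_iff_isWeightedHomogeneous_zero`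
(p526564: the adjoined generators contain the thirteen Hilbert monomials of `¼(1,1,2,3)`).
Pattern: res-type-087's J₄ `JordanFour.chart0_ringEquiv_adjoin` (p490009).
-/

-- single-problem summit: the doubled namespace component `ResolutionOfSingularities` is forced
set_option linter.dupNamespace false

noncomputable section

open MvPolynomial Literature.AlgebraicGeometry.Resolution

namespace Summit.ResolutionOfSingularities.ResolutionOfSingularities.Theorems.WildQuotientResolution.JordanFive

variable (k : Type) [Field k] (n : ℕ) (a b c d : Fin n)

/-- The root substitution of record `ψ₀` (stub-2's `root5` lambda, verbatim). -/
local notation3 "root5" => (fun i : Fin n => if i = a then X a ^ 4 else if i = b then X a ^ 3 * X b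
  else if i = c then X a ^ 2 * X c else if i = d then X a * X d else (X i : MvPolynomial (Fin n) k))

/-- The chart quotients `q_j = ψ₀(g_j)/x_a¹² = x_a^{4α+3β+2γ+δ−12} x_b^β x_c^γ x_d^δ`. -/
local notation3 "q5" => (fun j : Fin 40 =>
  (X a ^ (4 * (exps12 j).1 + 3 * (exps12 j).2.1 + 2 * (exps12 j).2.2.1 + (exps12 j).2.2.2 - 12) *
    X b ^ (exps12 j).2.1 * X c ^ (exps12 j).2.2.1 * X d ^ (exps12 j).2.2.2 : MvPolynomial (Fin n) k))

/-- `ψ₀` is the monomial twist `x_a ↦ x_a⁴, x_s ↦ x_s · x_a^{e_s}` with `e = (b ↦ 3, c ↦ 2, d ↦ 1,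
else 0)`. [folklore] -/
theorem aeval_root5_eq_monomialTwist (hab : a ≠ b) (hac : a ≠ c) (had : a ≠ d) (hbc : b ≠ c)
    (hbd : b ≠ d) (hcd : c ≠ d) :
    (MvPolynomial.aeval root5 : MvPolynomial (Fin n) k →ₐ[k] MvPolynomial (Fin n) k) =
      MvPolynomial.aeval (fun s : Fin n => (if s = a then X a ^ 4 else
        X s * X a ^ ((fun s : Fin n => if s = b then 3 else if s = c then 2 else if s = d then 1 else 0) s) :
          MvPolynomial (Fin n) k)) := by
  refine MvPolynomial.algHom_ext fun i => ?_
  rw [aeval_X, aeval_X]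
  by_cases hia : i = a
  · subst hia; simp
  by_cases hib : i = b
  · subst hib; simp [hia]; ring
  by_cases hic : i = c
  · subst hic; simp [hia, hib]; ring
  by_cases hid : i = d
  · subst hid; simp [hia, hib, hic]; ring
  · simp [hia, hib, hic, hid]

/-- `ψ₀` is injective. [folklore] -/
theorem aeval_root5_injective (hab : a ≠ b) (hac : a ≠ c) (had : a ≠ d) (hbc : b ≠ c) (hbd : b ≠ d)
    (hcd : c ≠ d) :
    Function.Injective (MvPolynomial.aeval root5 : MvPolynomial (Fin n) k →ₐ[k] MvPolynomial (Fin n) k) := by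
  rw [aeval_root5_eq_monomialTwist k n a b c d hab hac had hbc hbd hcd]
  exact ToricExit.monomialTwist_injective k n a 4 (by norm_num) _

/-- A monomial `x_a^i x_b^j x_c^l x_d^m` with `4 ∣ i + j + 2l + 3m` is weighted homogeneous of weight
`0` for the `μ₄`-weight `(1,1,2,3)`. [folklore] -/
theorem isWeightedHomogeneous_monomial_of_four_dvd (hab : a ≠ b) (hac : a ≠ c) (had : a ≠ d)
    (hbc : b ≠ c) (hbd : b ≠ d) (hcd : c ≠ d) (w : Fin n → ZMod 4) (hwa : w a = 1) (hwb : w b = 1)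
    (hwc : w c = 2) (hwd : w d = 3) (hw0 : ∀ i, i ≠ a → i ≠ b → i ≠ c → i ≠ d → w i = 0)
    (i j l m : ℕ) (h : 4 ∣ i + j + 2 * l + 3 * m) :
    IsWeightedHomogeneous w (X a ^ i * X b ^ j * X c ^ l * X d ^ m : MvPolynomial (Fin n) k) 0 := by
  classical
  have hmon : (X a ^ i * X b ^ j * X c ^ l * X d ^ m : MvPolynomial (Fin n) k) =
      monomial (i • Finsupp.single a 1 + j • Finsupp.single b 1 + l • Finsupp.single c 1 +
        m • Finsupp.single d 1) 1 := by
    rw [X_pow_eq_monomial, X_pow_eq_monomial, X_pow_eq_monomial, X_pow_eq_monomial, monomial_mul,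
      monomial_mul, monomial_mul]
    simp only [mul_one, Finsupp.smul_single, smul_eq_mul]
  rw [hmon]
  have hw : Finsupp.weight w (i • Finsupp.single a 1 + j • Finsupp.single b 1 + l • Finsupp.single c 1 +
      m • Finsupp.single d 1) = 0 := by
    rw [Quarter1123.weight_eq_zero_iff w hwa hwb hwc hwd hw0 hab hac had hbc hbd hcd]
    simp only [exps_finsupp_apply n a b c d hab hac had hbc hbd hcd, Pi.single_apply]
    simp [hab.symm, hac.symm, had.symm, hbc.symm, hbd.symm, hcd.symm, hab, hac, had, hbc, hbd, hcd]
    exact h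
  rw [← hw]
  exact isWeightedHomogeneous_monomial w _ _ rfl

/-- The arithmetic of the chart quotients: for `(α,β,γ,δ) = exps12 j`,
`4 ∣ (4α+3β+2γ+δ−12) + β + 2γ + 3δ`. [folklore] -/
theorem four_dvd_exps12 (j : Fin 40) :
    4 ∣ (4 * (exps12 j).1 + 3 * (exps12 j).2.1 + 2 * (exps12 j).2.2.1 + (exps12 j).2.2.2 - 12) +
      (exps12 j).2.1 + 2 * (exps12 j).2.2.1 + 3 * (exps12 j).2.2.2 := by
  fin_cases j <;> decide

set_option maxHeartbeats 1600000 in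
/-- **(A1) `(k[x][I₁₂t])_{(x_a³t)} ≅ E₀`** (see the module docstring). [OURS · L1 W4.5c]
[folklore; assembly of landed decls] -/
theorem exists_ringEquiv_blowupChart0_weightZero (hab : a ≠ b) (hac : a ≠ c) (had : a ≠ d)
    (hbc : b ≠ c) (hbd : b ≠ d) (hcd : c ≠ d) (w : Fin n → ZMod 4) (hwa : w a = 1) (hwb : w b = 1)
    (hwc : w c = 2) (hwd : w d = 3) (hw0 : ∀ i, i ≠ a → i ≠ b → i ≠ c → i ≠ d → w i = 0)
    (E : Subalgebra k (MvPolynomial (Fin n) k)) (hE : ∀ f, f ∈ E ↔ IsWeightedHomogeneous w f 0) :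
    ∃ eE : chartRing (gens12 k n a b c d) 0 ≃+* ↥E,
      (∀ F : MvPolynomial (Fin n) k,
        ((eE (chartBase (gens12 k n a b c d) 0 F) : ↥E) : MvPolynomial (Fin n) k) =
          MvPolynomial.aeval root5 F) ∧
      ∀ j : Fin 40,
        ((eE (chartGen (gens12 k n a b c d) 0 j) : ↥E) : MvPolynomial (Fin n) k) =
          X a ^ (4 * (exps12 j).1 + 3 * (exps12 j).2.1 + 2 * (exps12 j).2.2.1 + (exps12 j).2.2.2 - 12) *
            X b ^ (exps12 j).2.1 * X c ^ (exps12 j).2.2.1 * X d ^ (exps12 j).2.2.2 := by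
  classical
  let ψ₀ : MvPolynomial (Fin n) k →ₐ[k] MvPolynomial (Fin n) k := MvPolynomial.aeval root5
  have hψdef : ψ₀ = MvPolynomial.aeval root5 := rfl
  have hinj : Function.Injective ψ₀ := aeval_root5_injective k n a b c d hab hac had hbc hbd hcd
  have hg0 : gens12 k n a b c d 0 = X a ^ 3 := rfl
  have hψa : ψ₀ (X a) = X a ^ 4 := root5_X_a k n a b c d
  have hψb : ψ₀ (X b) = X a ^ 3 * X b := root5_X_b k n a b c d hab
  have hψc : ψ₀ (X c) = X a ^ 2 * X c := root5_X_c k n a b c d hac hbc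
  have hψd : ψ₀ (X d) = X a * X d := root5_X_d k n a b c d had hbd hcd
  have hψ0 : ψ₀ (gens12 k n a b c d 0) = X a ^ 12 := by
    rw [hg0, map_pow, hψa, ← pow_mul]
  have hunit : ψ₀ (gens12 k n a b c d 0) * 1 = gens12 k n a b c d 0 ^ 4 := by
    rw [hψ0, hg0, ← pow_mul, mul_one]
  have hq : ∀ j : Fin 40, ψ₀ (gens12 k n a b c d j) = q5 j * ψ₀ (gens12 k n a b c d 0) := by
    intro j
    rw [hψ0, mul_comm]
    exact aeval_root5_gens12 k n a b c d hab hac had hbc hbd hcd j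
  let G : Set (MvPolynomial (Fin n) k) := Set.range (fun s : Fin n => ψ₀ (X s)) ∪ Set.range q5
  obtain ⟨e, hbase, hgen⟩ : ∃ e : chartRing (gens12 k n a b c d) 0 ≃+* ↥(Algebra.adjoin k G),
      (∀ f : MvPolynomial (Fin n) k,
        ((e (chartBase (gens12 k n a b c d) 0 f) : ↥(Algebra.adjoin k G)) : MvPolynomial (Fin n) k) =
          ψ₀ f) ∧
      ∀ j : Fin 40, ((e (chartGen (gens12 k n a b c d) 0 j) : ↥(Algebra.adjoin k G)) :
        MvPolynomial (Fin n) k) = q5 j :=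
    ToricExit.nonempty_chartRing_ringEquiv_adjoin_of_rootData k (gens12 k n a b c d) 0
      (by rw [hg0]; exact pow_ne_zero _ (X_ne_zero a)) ψ₀ hinj 1 4 hunit q5 hq
  -- the adjoined generators are the weight-0 part `E`
  have hψX : ∀ s, ψ₀ (X s) ∈ Algebra.adjoin k G := fun s => Algebra.subset_adjoin (Or.inl ⟨s, rfl⟩)
  have hqG : ∀ j, q5 j ∈ Algebra.adjoin k G := fun j => Algebra.subset_adjoin (Or.inr ⟨j, rfl⟩)
  have hW : ∀ g ∈ G, IsWeightedHomogeneous w g 0 := by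
    rintro g (⟨s, rfl⟩ | ⟨j, rfl⟩)
    · change IsWeightedHomogeneous w (ψ₀ (X s)) 0
      by_cases hsa : s = a
      · rw [hsa, hψa]
        simpa using isWeightedHomogeneous_monomial_of_four_dvd k n a b c d hab hac had hbc hbd hcd w
          hwa hwb hwc hwd hw0 4 0 0 0 (by norm_num)
      by_cases hsb : s = b
      · rw [hsb, hψb]
        simpa using isWeightedHomogeneous_monomial_of_four_dvd k n a b c d hab hac had hbc hbd hcd w
          hwa hwb hwc hwd hw0 3 1 0 0 (by norm_num)
      by_cases hsc : s = c
      · rw [hsc, hψc]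
        simpa using isWeightedHomogeneous_monomial_of_four_dvd k n a b c d hab hac had hbc hbd hcd w
          hwa hwb hwc hwd hw0 2 0 1 0 (by norm_num)
      by_cases hsd : s = d
      · rw [hsd, hψd]
        simpa using isWeightedHomogeneous_monomial_of_four_dvd k n a b c d hab hac had hbc hbd hcd w
          hwa hwb hwc hwd hw0 1 0 0 1 (by norm_num)
      · have hs : ψ₀ (X s) = X s := by
          change MvPolynomial.aeval root5 (X s) = X s
          rw [aeval_X]; simp [hsa, hsb, hsc, hsd]
        rw [hs, ← hw0 s hsa hsb hsc hsd]
        exact isWeightedHomogeneous_X k w s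
    · exact isWeightedHomogeneous_monomial_of_four_dvd k n a b c d hab hac had hbc hbd hcd w hwa hwb
        hwc hwd hw0 _ _ _ _ (four_dvd_exps12 j)
  -- the thirteen Hilbert monomials and the passengers lie in `adjoin k G`
  have m40 : (X a ^ 4 : MvPolynomial (Fin n) k) ∈ Algebra.adjoin k G := hψa ▸ hψX a
  have m31 : (X a ^ 3 * X b : MvPolynomial (Fin n) k) ∈ Algebra.adjoin k G := hψb ▸ hψX b
  have m201 : (X a ^ 2 * X c : MvPolynomial (Fin n) k) ∈ Algebra.adjoin k G := hψc ▸ hψX c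
  have m1001 : (X a * X d : MvPolynomial (Fin n) k) ∈ Algebra.adjoin k G := hψd ▸ hψX d
  have m22 : (X a ^ 2 * X b ^ 2 : MvPolynomial (Fin n) k) ∈ Algebra.adjoin k G := by
    have h := hqG 39; simp [exps12] at h; simpa using h
  have m13 : (X a * X b ^ 3 : MvPolynomial (Fin n) k) ∈ Algebra.adjoin k G := by
    have h := hqG 35; simp [exps12] at h; simpa using h
  have m04 : (X b ^ 4 : MvPolynomial (Fin n) k) ∈ Algebra.adjoin k G := by
    have h := hqG 1; simp [exps12] at h; simpa using h
  have m111 : (X a * X b * X c : MvPolynomial (Fin n) k) ∈ Algebra.adjoin k G := by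
    have h := hqG 34; simp [exps12] at h; simpa using h
  have m021 : (X b ^ 2 * X c : MvPolynomial (Fin n) k) ∈ Algebra.adjoin k G := by
    have h := hqG 8; simp [exps12] at h; simpa using h
  have m002 : (X c ^ 2 : MvPolynomial (Fin n) k) ∈ Algebra.adjoin k G := by
    have h := hqG 5; simp [exps12] at h; simpa using h
  have m0101 : (X b * X d : MvPolynomial (Fin n) k) ∈ Algebra.adjoin k G := by
    have h := hqG 4; simp [exps12] at h; simpa using h
  have m0012 : (X c * X d ^ 2 : MvPolynomial (Fin n) k) ∈ Algebra.adjoin k G := by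
    have h := hqG 6; simp [exps12] at h; simpa using h
  have m0004 : (X d ^ 4 : MvPolynomial (Fin n) k) ∈ Algebra.adjoin k G := by
    have h := hqG 7; simp [exps12] at h; simpa using h
  have mpass : ∀ i, i ≠ a → i ≠ b → i ≠ c → i ≠ d →
      (X i : MvPolynomial (Fin n) k) ∈ Algebra.adjoin k G := by
    intro i hia hib hic hid
    have hs : ψ₀ (X i) = X i := by
      change MvPolynomial.aeval root5 (X i) = X i
      rw [aeval_X]; simp [hia, hib, hic, hid]
    exact hs ▸ hψX i
  have hEq : Algebra.adjoin k G = E := by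
    ext f
    rw [hE f]
    exact Quarter1123.mem_adjoin_iff_isWeightedHomogeneous_zero w hwa hwb hwc hwd hw0 hab hac had hbc
      hbd hcd G hW m40 m31 m22 m13 m04 m201 m111 m021 m002 m1001 m0101 m0012 m0004 mpass f
  refine ⟨e.trans (Subalgebra.equivOfEq _ _ hEq).toRingEquiv, fun F => ?_, fun j => ?_⟩
  · change ((Subalgebra.equivOfEq _ _ hEq (e (chartBase (gens12 k n a b c d) 0 F)) : ↥E) :
        MvPolynomial (Fin n) k) = _
    exact hbase F
  · change ((Subalgebra.equivOfEq _ _ hEq (e (chartGen (gens12 k n a b c d) 0 j)) : ↥E) :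
        MvPolynomial (Fin n) k) = _
    exact hgen j

end Summit.ResolutionOfSingularities.ResolutionOfSingularities.Theorems.WildQuotientResolution.JordanFive

end
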